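import Summits.CriticalPhenomena.SAWScalingLimit.Theorems.IsingBoundaryRatio.Negative.IsingBoundaryRatioLattice
import Literature.Probability.LatticeModels.IsingDisorderFermion
import Literature.Probability.LatticeModels.PlaquetteWalkParity

/-!
# Line `double-cut-positive-kernel` for the crux `IsingBoundaryRatio` (stmt-CriticalPhenomena-10650)

Crux (route SAWLoopFugacityFlow, rank 6, the `n = 1` anchor): for nested Dobrushin domains `D' ⊆ D`
agreeing near the marked points `a, b`, lattice endpoints `(a_δ, b_δ)` that are an endpoint
approximation in both `Ω_δ` and `Ω'_δ`, a chordal uniformizer `φ`, the pulled-back hull `A`, its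
restriction map `Φ` and `d = Φ'_A(0)`:
`⟨σ_{a_δ}σ_{b_δ}⟩^free_{Ω'_δ,β_c} / ⟨σ_{a_δ}σ_{b_δ}⟩^free_{Ω_δ,β_c} → d^{1/2}` along `δ → 0⁺`.

IDEA (card `Ideas/double-cut-positive-kernel.md`, ideator 2; triage r1: pass ×3). Never normalise a
fermion AT a rough boundary point. Cut the domain near `a` (cap `U_a`, common to `Ω_δ` and `Ω'_δ`)
and near `b`: Hongler–Kytölä's convolution representation of the discrete Riemann boundary value
problem (arXiv:1108.0643, Lemmas 64–67) writes the boundary two-point function as a POSITIVE cap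
average (weights `K_a(y) = E^free_{U_a}[σ_{a_δ}σ_y] > 0`, identical for the two domains) of the
`b`-sourced spin fermion on the cut, and the `b`-sourced fermion at an interior point as a positive
cap-`b` average of the ABSOLUTELY normalised bulk two-point fermion. The skeleton below realises this
as "two ends, each cut once":

* `stub_capCutIdentity` — the EXACT finite-`δ` identity at the `a`-cap (the lever, HK Lemma 67 + 64):
  `E^free_{Ω̂_δ}[σ_{a_δ}σ_{b_δ}] = c(δ) · ‖Σ_{cut pairs (v,w)} Σ_k ζ(w-v,k) K_a(v) X_{Ω̂_δ}(v, k; b)‖`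
  for `Ω̂ ∈ {D, D'}` with ONE common constant `c(δ) > 0`, where `X` is the Kadanoff–Ceva corner
  value `E^free_{Ω̂_δ}[μ_T σ_v σ_{b_δ}]` (tree: `kcCorner`, disorder line `T` from a boundary plaquette
  at `b_δ` to the plaquette of the corner) and `ζ` are 16 lattice constants (projection phases).
* `stub_anchorToFermion` — the `a`-END LIMIT (conformal-data-free!): under the identity, the
  doubly self-normalised quotient `‖A_{D'}‖·M_D(x₀) / (‖A_D‖·M_{D'}(x₀))`, `M_{Ω̂}(x₀)` = modulus of
  the `b`-sourced lattice fermion of `Ω̂_δ` at an interior reference point `x₀`, converges for each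
  `x₀` near `a` to some `Λ_a(x₀)` with `Λ_a(x₀) → 1` as `x₀ → a` (kernel-shape convergence HK
  Thm 83 + the continuum representation at `a` read in the chart `φ`; expected
  `Λ_a(x₀) = d^{1/2}/|Φ'_A(φ⁻¹x₀)|^{1/2}`).
* `stub_fermionModulusRatio` — the `b`-END LIMIT (carries the VALUE): `M_{D'}(x₀)/M_D(x₀) → Λ_b(x₀)`
  with `Λ_b(x₀) → d^{1/2}` as `x₀ → a` (the `b`-cap identity + ABSOLUTE convergence of the bulk
  two-point Kadanoff–Ceva fermion in the rough domains `D, D'` — the one non-printed analytic input,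
  Hongler–Smirnov 2013 smooth / CHI 2021 technology — + the chart value at `∞`, `Φ_A(w) ∼ w`;
  expected `Λ_b(x₀) = |Φ'_A(φ⁻¹x₀)|^{1/2}`).
* `stub_anchorIndependence`, `stub_boundaryApprox` — the SHARED anchor-locality items (verbatim the
  sibling card fk-anchor-renewal's `AnchorIndependence`, `ExistsBoundaryApprox`, SketchIdeator2.lean):
  transfer from boundary-vertex anchors to every `IsEndpointApprox` (interior anchors at mesoscopic
  depth), which the double cut does not reach by itself (triage cross-card note).

COMPOSITION (proved below, no sorry): eventually `ratio_δ = ‖A_{D'}‖/‖A_D‖ = P^a_δ(x₀)·P^b_δ(x₀)`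
for every interior `x₀` near `a`, so `lim ratio_δ = Λ_a(x₀)Λ_b(x₀)` is an `x₀`-independent constant,
equal (let `x₀ → a` inside `D'`) to `1 · d^{1/2}`; this is the boundary-anchor case in normal form
(`Negative.inline_eq_T`), and the transfer step (filter algebra, from SketchIdeator2, inlined in
`IsingBoundaryRatio_of`) gives the crux as typed.

DISPROOF USED (Cruxes/IsingBoundaryRatio/Disproof.lean, cdisprove gen 1 rev 3; landed Negative/
IsingBoundaryRatio{Lattice,Nesting,Normalisation}): `isingBoundaryRatio_false_without_IsRestrictionMap`
/ `_HasRestrictionDeriv` are honoured — the value `d` enters only through `stub_fermionModulusRatio`,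
which is stated inside the full `(φ, A, Φ, d)` shell with BOTH clauses; the load-bearing inner
approximation `IsEndpointApprox D' a b` (§3 of the work file) is a hypothesis of every lattice stub;
all limits are along `𝓝[>] 0` (no `0772`-pattern, cf. `not_tendsto_twoSided`); `crux_diag`
(`D' = D ⇒ d = 1`) is consistent with every stub (then `A_D = A_{D'}`, `M_D = M_{D'}`, `Λ_a = Λ_b·… = 1`);
the composition uses `Negative.inline_eq_T` (p73059) and nothing refuted. No stub is an instance of a
landed Negative lemma (those concern deleted hypotheses / two-sided filters / negative exponents).

Everything is stated over existing declarations: `isingTwoPoint`, `kcCorner` (IsingDisorderFermion),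
`crossSet` (PlaquetteWalkParity), `faceAt`, `plaqSide`, `meshDomainFinset`, `nearestSite`,
`discreteDomainGraph`, `SAW.IsEndpointApprox`, the restriction-hull vocabulary of the route file, and
`Negative.T` / `Negative.ratio` of the landed Negative file.
-/

noncomputable section

open scoped Classical Topology BigOperators
open Filter Set Metric MeasureTheory
open Literature.Probability.LatticeModels Literature.Probability.RandomPlanarGeometry
open UpperHalfPlane (upperHalfPlaneSet)
open Summit.CriticalPhenomena.SAWScalingLimit.Theorems.IsingBoundaryRatio

namespace Summit.CriticalPhenomena.SAWScalingLimit.Cruxes.IsingBoundaryRatio.DoubleCutPositiveKernel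

/-! ## §1 Vocabulary shared with the sibling lines (verbatim from `SketchIdeator2.lean`) -/

/-- The crux's inline quantity: the free-b.c. critical Ising two-point function on the mesh graph
`Ω_δ` for a given locally-finite structure `lf` (a subsingleton); equal to `Negative.T Ω δ x y`
(`Negative.inline_eq_T`). -/
def twoPt (lf : ∀ (Ω : Set ℂ) (δ : ℝ), (discreteDomainGraph Ω δ).LocallyFinite)
    (Ω : Set ℂ) (δ : ℝ) (x y : Site 2) : ℝ :=
  @Literature.Probability.LatticeModels.isingTwoPoint _ (discreteDomainGraph Ω δ) _ (lf Ω δ)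
    (if h : Bornology.IsBounded Ω ∧ 0 < δ then (meshDomain_finite h.1 h.2).toFinset else ∅)
    (Real.log (1 + Real.sqrt 2) / 2) 0 BoundaryCondition.free x y

/-- `D' ⊆ D` is a hull subdomain with the same marked points, agreeing with `D` in balls around
them (verbatim the crux's hypotheses h3–h6). -/
def IsNested (D D' : DobrushinDomain) : Prop :=
  D'.carrier ⊆ D.carrier ∧ D'.pt 0 = D.pt 0 ∧ D'.pt 1 = D.pt 1 ∧
    ∃ ε : ℝ, 0 < ε ∧ D'.carrier ∩ Metric.ball (D.pt 0) ε = D.carrier ∩ Metric.ball (D.pt 0) ε ∧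
      D'.carrier ∩ Metric.ball (D.pt 1) ε = D.carrier ∩ Metric.ball (D.pt 1) ε

/-- The lattice anchor `a δ` is (eventually) a BOUNDARY VERTEX of `Ω_δ`: a vertex of the mesh domain
with a `ℤ²`-neighbour not joined to it in `Ω_δ` (so a boundary plaquette / boundary corner at `a δ`
exists and Hongler–Kytölä's Lemma 64 applies). -/
def IsBoundaryAnchor (Ω : Set ℂ) (a : ℝ → Site 2) : Prop :=
  ∀ᶠ δ in 𝓝[>] (0 : ℝ), a δ ∈ meshDomain Ω δ ∧
    ∃ v : Site 2, (zdGraph 2).Adj (a δ) v ∧ ¬ (discreteDomainGraph Ω δ).Adj (a δ) v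

/-- The nested ratio along an endpoint approximation (inline form). -/
def ratio (lf : ∀ (Ω : Set ℂ) (δ : ℝ), (discreteDomainGraph Ω δ).LocallyFinite)
    (D D' : DobrushinDomain) (a b : ℝ → Site 2) (δ : ℝ) : ℝ :=
  twoPt lf D'.carrier δ (a δ) (b δ) / twoPt lf D.carrier δ (a δ) (b δ)

/-- The crux's conclusion shell for a given endpoint approximation (inline form). -/
def RatioTendsto (lf : ∀ (Ω : Set ℂ) (δ : ℝ), (discreteDomainGraph Ω δ).LocallyFinite)
    (D D' : DobrushinDomain) (a b : ℝ → Site 2) : Prop :=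
  ∀ (φ : ConformalEquiv upperHalfPlaneSet D.carrier), D.IsChordalUniformizing φ →
    ∀ (A : Set ℂ), A = closure (upperHalfPlaneSet \ {z | z ∈ upperHalfPlaneSet ∧ φ z ∈ D'.carrier}) →
    ∀ (Φ : ConformalEquiv (upperHalfPlaneSet \ A) upperHalfPlaneSet) (d : ℝ),
      IsRestrictionMap A Φ → HasRestrictionDeriv A Φ d →
      Tendsto (ratio lf D D' a b) (𝓝[>] 0) (𝓝 (d ^ ((1 : ℝ) / 2)))

/-- The same shell in the library normal form (`Negative.ratio`, no `lf`). -/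
def RatioTendstoNF (D D' : DobrushinDomain) (a b : ℝ → Site 2) : Prop :=
  ∀ (φ : ConformalEquiv upperHalfPlaneSet D.carrier), D.IsChordalUniformizing φ →
    ∀ (A : Set ℂ), A = closure (upperHalfPlaneSet \ {z | z ∈ upperHalfPlaneSet ∧ φ z ∈ D'.carrier}) →
    ∀ (Φ : ConformalEquiv (upperHalfPlaneSet \ A) upperHalfPlaneSet) (d : ℝ),
      IsRestrictionMap A Φ → HasRestrictionDeriv A Φ d →
      Tendsto (Negative.ratio D D' a b) (𝓝[>] 0) (𝓝 (d ^ ((1 : ℝ) / 2)))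

/-- OUTPUT of the line (NOT a stub — the triage's costume warning): the crux restricted to endpoint
approximations whose anchors are boundary vertices of `Ω_δ`. -/
def BoundaryAnchorRatio : Prop :=
  ∀ (lf : ∀ (Ω : Set ℂ) (δ : ℝ), (discreteDomainGraph Ω δ).LocallyFinite)
    (D D' : DobrushinDomain) (a b : ℝ → Site 2),
    SAW.IsEndpointApprox D a b → SAW.IsEndpointApprox D' a b → IsNested D D' →
    IsBoundaryAnchor D.carrier a → IsBoundaryAnchor D.carrier b →
    RatioTendsto lf D D' a b

/-- SHARED STUB (sibling card fk-anchor-renewal, verbatim): anchor independence — for two endpoint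
approximations of the same marked prime ends the difference of nested ratios tends to `0`
(value-free; Edwards–Sokal + b.c.-uniform RSW in rough discrete quads + FKG + renewal across
conformal half-annuli; only the separating direction is needed). -/
def AnchorIndependence : Prop :=
  ∀ (lf : ∀ (Ω : Set ℂ) (δ : ℝ), (discreteDomainGraph Ω δ).LocallyFinite)
    (D D' : DobrushinDomain) (a b a' b' : ℝ → Site 2),
    SAW.IsEndpointApprox D a b → SAW.IsEndpointApprox D' a b →
    SAW.IsEndpointApprox D a' b' → SAW.IsEndpointApprox D' a' b' → IsNested D D' →
    Tendsto (fun δ => ratio lf D D' a b δ - ratio lf D D' a' b' δ) (𝓝[>] 0) (𝓝 0)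

/-- SHARED STUB (sibling card fk-anchor-renewal, verbatim): existence of ONE endpoint approximation by
boundary vertices common to `D` and `D'` (nearest boundary vertices of the common piece of the mesh
graphs inside the agreement balls; lattice geometry, size S–M). -/
def ExistsBoundaryApprox : Prop :=
  ∀ (D D' : DobrushinDomain), IsNested D D' →
    ∃ a b : ℝ → Site 2, SAW.IsEndpointApprox D a b ∧ SAW.IsEndpointApprox D' a b ∧
      IsBoundaryAnchor D.carrier a ∧ IsBoundaryAnchor D.carrier b

/-! ## §2 The double-cut data (all caps are computed from the OUTER domain `D`: common data) -/

/-- The open axis-parallel square `Q(p, ρ)` of half-width `ρ` around `p` (HK13's `Q(a, ϱ)`). -/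
def sqNhd (p : ℂ) (ρ : ℝ) : Set ℂ := {z | |(z - p).re| < ρ ∧ |(z - p).im| < ρ}

/-- The CAP VOLUME at `p`: mesh-domain sites of `Ω_δ` whose mesh point lies in `Q(p, ρ)` (the vertex
set of HK13's cap `U_p`; the free Ising model on the cap = graph `Ω_δ` with this free volume, i.e.
couplings only along edges of `Ω_δ` inside the cap). -/
def capVol (Ω : Set ℂ) (p : ℂ) (ρ δ : ℝ) : Finset (Site 2) :=
  (meshDomainFinset Ω δ).filter fun v => meshPoint δ v ∈ sqNhd p ρ

/-- The CAP KERNEL `K(s, v) = E^free_{U}[σ_s σ_v]` of the cap at `p` (critical, zero field, free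
b.c. on the cap): by GKS-I it is `≥ 0`, `> 0` iff `v` is joined to `s` inside the cap, and by HK13
Lemma 64 it is `α⁻¹ ×` the modulus of the cap's spin fermion between the boundary corners at `s`
and at `v` — the POSITIVE weight of the double cut. -/
def capKernel (Ω : Set ℂ) (p : ℂ) (ρ δ : ℝ) (s v : Site 2) : ℝ :=
  isingTwoPoint (discreteDomainGraph Ω δ) (capVol Ω p ρ δ) criticalBetaTwo 0 BoundaryCondition.free s v

/-- The CUT: ordered pairs `(v, w)` with `v` in the cap, `w` in the mesh domain outside the cap, and
`{v, w}` an edge of `Ω_δ` (the medial vertices of HK13's straight part `𝔰` of `∂U_p`; they cross the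
four sides of the square, each side a straight lattice cut). -/
def cutPairs (Ω : Set ℂ) (p : ℂ) (ρ δ : ℝ) : Finset (Site 2 × Site 2) :=
  (capVol Ω p ρ δ ×ˢ meshDomainFinset Ω δ).filter fun q =>
    (discreteDomainGraph Ω δ).Adj q.1 q.2 ∧ q.2 ∉ capVol Ω p ρ δ

/-- The `b`-SOURCED KADANOFF–CEVA VALUE of `Ω_δ` at the corner `(v, q)`:
`X_{Ω_δ}(v, q; b) = E^free_{Ω_δ}[μ_T σ_v σ_{bδ}]` (tree `kcCorner`, free b.c., background spin `{bδ}`),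
the disorder line `T` being the set of EDGES of `Ω_δ` crossed (an odd number of times) by the
`ℤ²`-dual walk `W` from a plaquette `p` (meant: a boundary plaquette at `bδ`, i.e. the outer face) to
the plaquette `q` of the corner. Another walk with the same ends changes `T` by the edge boundary of
the enclosed sites, hence `X` at most by a sign (gauge; CHI21 Lemma 2.6). For `p` in the outer face
this is, up to the corner phase, the spin fermion of `Ω_δ` sourced at the boundary corner `(bδ, p)`
(HK13 Def. 59 / CHI21 Def. 2.8), whose values at boundary corners are `± E^free[σ_v σ_{bδ}]`. -/
def bFermion (Ω : Set ℂ) (δ : ℝ) (bδ : Site 2) {p q : Site 2} (W : (zdGraph 2).Walk p q)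
    (v : Site 2) : ℝ :=
  kcCorner (discreteDomainGraph Ω δ) (meshDomainFinset Ω δ) criticalBetaTwo BoundaryCondition.free
    {bδ} ((crossSet W).filter fun e => e ∈ (discreteDomainGraph Ω δ).edgeSet) v

/-- `pb` is a BOUNDARY PLAQUETTE AT `bδ` of `Ω_δ`: a unit plaquette having `bδ` as a corner and a
side which is not an edge of `Ω_δ` (so `pb` is merged into the outer face of the planar graph `Ω_δ`
— a Jordan discretisation has no other non-square faces — and a disorder line issued from `pb` is a
boundary source). It exists as soon as `bδ` is a boundary vertex (`IsBoundaryAnchor`). -/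
def IsBdryPlaquette (Ω : Set ℂ) (δ : ℝ) (bδ pb : Site 2) : Prop :=
  (∃ k : Fin 4, pb = faceAt bδ k) ∧ ∃ j : Fin 4, plaqSide pb j ∉ (discreteDomainGraph Ω δ).edgeSet

/-- The `a`-CAP SUM `A_{Ω̂}(δ) = Σ_{(v,w) ∈ cut} Σ_{k : Fin 4} ζ(w - v, k) · K_a(v) · X_{Ω̂_δ}(v, faceAt v k; b)`:
the cap-`a` kernel of the OUTER domain `D` (common to `D` and `D'`) against the `b`-sourced fermion of
`Ω̂ ∈ {D, D'}` at the four corners of the inner cut site `v`, with lattice constants `ζ` (one complex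
number per bond direction and corner type: the projection `P_{ν_in^{-1/2}}` of HK13 Lemma 67 and the
lattice-pinned phase of the kernel column `g(U_a; y, a)`, constant along each straight side). -/
def capSum (D : DobrushinDomain) (Ω : Set ℂ) (a b : ℝ → Site 2) (ρ : ℝ) (ζ : Site 2 → Fin 4 → ℂ)
    (pb : ℝ → Site 2) (W : (δ : ℝ) → (q : Site 2) → (zdGraph 2).Walk (pb δ) q) (δ : ℝ) : ℂ :=
  ∑ q ∈ cutPairs D.carrier (D.pt 0) ρ δ, ∑ k : Fin 4,
    ζ (q.2 - q.1) k * ((capKernel D.carrier (D.pt 0) ρ δ (a δ) q.1 : ℝ) : ℂ) *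
      ((bFermion Ω δ (b δ) (W δ (faceAt q.1 k)) q.1 : ℝ) : ℂ)

/-- The REFERENCE MODULUS `M_{Ω̂}(δ, x₀)`: the modulus of the `b`-sourced lattice fermion of `Ω̂_δ` at
the interior point `x₀`, read off two corners of ORTHOGONAL types (`faceAt · 0`, `faceAt · 2`) at
the site `x₀* = nearestSite δ x₀` — a sum of squares, hence independent of the walks/gauge, and never
degenerate (no single projection is used: at a rough prime end a fixed projection of the fermion may
oscillate in sign, the modulus may not). -/
def refModulus (Ω : Set ℂ) (b : ℝ → Site 2) (pb : ℝ → Site 2)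
    (W : (δ : ℝ) → (q : Site 2) → (zdGraph 2).Walk (pb δ) q) (δ : ℝ) (x₀ : ℂ) : ℝ :=
  Real.sqrt (bFermion Ω δ (b δ) (W δ (faceAt (nearestSite δ x₀) 0)) (nearestSite δ x₀) ^ 2 +
    bFermion Ω δ (b δ) (W δ (faceAt (nearestSite δ x₀) 2)) (nearestSite δ x₀) ^ 2)

/-- THE `a`-CAP CUT IDENTITY PACKAGE for given data `(ρ, ζ, c, pb, W)`: eventually along `δ → 0⁺`,
`c δ > 0`, `pb δ` is a boundary plaquette at `b δ`, and for BOTH domains `Ω̂ ∈ {D, D'}`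
`⟨σ_{aδ}σ_{bδ}⟩^free_{Ω̂_δ} = c δ · ‖A_{Ω̂}(δ)‖` with the SAME `c δ` (cap-only constant: HK13's `α`, the
cap normalisation and the scale of "the value at the rough point `a`"). -/
def CapCutIdentity (D D' : DobrushinDomain) (a b : ℝ → Site 2) (ρ : ℝ) (ζ : Site 2 → Fin 4 → ℂ)
    (c : ℝ → ℝ) (pb : ℝ → Site 2) (W : (δ : ℝ) → (q : Site 2) → (zdGraph 2).Walk (pb δ) q) : Prop :=
  ∀ᶠ δ in 𝓝[>] (0 : ℝ), 0 < c δ ∧ IsBdryPlaquette D.carrier δ (b δ) (pb δ) ∧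
    Negative.T D.carrier δ (a δ) (b δ) = c δ * ‖capSum D D.carrier a b ρ ζ pb W δ‖ ∧
    Negative.T D'.carrier δ (a δ) (b δ) = c δ * ‖capSum D D'.carrier a b ρ ζ pb W δ‖

/-! ## §3 The stubs -/

/-- Statement of `stub_capCutIdentity`. -/
def CapCutIdentityStmt : Prop :=
  ∀ (D D' : DobrushinDomain) (a b : ℝ → Site 2),
    SAW.IsEndpointApprox D a b → SAW.IsEndpointApprox D' a b → IsNested D D' →
    IsBoundaryAnchor D.carrier a → IsBoundaryAnchor D.carrier b →
    ∃ ρ : ℝ, 0 < ρ ∧ D'.carrier ∩ ball (D.pt 0) (4 * ρ) = D.carrier ∩ ball (D.pt 0) (4 * ρ) ∧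
      ∃ (ζ : Site 2 → Fin 4 → ℂ) (c : ℝ → ℝ) (pb : ℝ → Site 2)
        (W : (δ : ℝ) → (q : Site 2) → (zdGraph 2).Walk (pb δ) q), CapCutIdentity D D' a b ρ ζ c pb W

/-- **STUB 1 — the `a`-cap cut identity (the lever; exact, finite `δ`).** For boundary-vertex anchors
there are a cap half-width `ρ > 0` with `D = D'` inside `B(a, 4ρ)` (so the caps of `D` and `D'` at `a`
are the same lattice piece), lattice constants `ζ`, cap-only
constants `c δ > 0`, boundary plaquettes `pb δ` at `b δ` and dual walks `W δ q` such that for all small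
`δ > 0` and for BOTH `Ω̂ = D, D'`: `⟨σ_{aδ}σ_{bδ}⟩^free_{Ω̂_δ} = c δ · ‖A_{Ω̂}(δ)‖`.
WHY TRUE: HK13 (arXiv:1108.0643) Lemma 67 — an s-holomorphic function on the cap `U_a` with Riemann
boundary values on `∂Ω̂ ∩ U_a` equals the convolution of its (projected) values on the cut with the
kernel `g(U_a; y, ·)`; applied to `y ↦ F_{Ω̂}(b; y)` and evaluated at the boundary corner at `a δ`,
where `|F_{Ω̂}(b; a)| = α E^free_{Ω̂}[σ_aσ_b]` and `|g(U_a; y, a)| = α E^free_{U_a}[σ_aσ_{y'}] = α K_a(y')`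
(Lemma 64, Remark 60) with a phase pinned by the side of the square (Lemma 62 + windings constant along
a straight side). The cap of `D'` at `a` coincides with that of `D` on the component of `a δ` (the
square sits inside the agreement ball; `a δ ∈ Ω'_δ`), and `K_a` vanishes off that component, so the
`D`-cap data serve both domains and `c` is common. SIZE: L (discrete RBVP uniqueness on the cap,
kernel construction, free-b.c. Kadanoff–Ceva bookkeeping; no limits). Numerically checkable by
Kac–Ward (the card's j008858 machinery). -/
theorem stub_capCutIdentity :
    ∀ (D D' : DobrushinDomain) (a b : ℝ → Site 2),
      SAW.IsEndpointApprox D a b → SAW.IsEndpointApprox D' a b → IsNested D D' →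
      IsBoundaryAnchor D.carrier a → IsBoundaryAnchor D.carrier b →
      ∃ ρ : ℝ, 0 < ρ ∧ D'.carrier ∩ ball (D.pt 0) (4 * ρ) = D.carrier ∩ ball (D.pt 0) (4 * ρ) ∧
        ∃ (ζ : Site 2 → Fin 4 → ℂ) (c : ℝ → ℝ) (pb : ℝ → Site 2)
          (W : (δ : ℝ) → (q : Site 2) → (zdGraph 2).Walk (pb δ) q), CapCutIdentity D D' a b ρ ζ c pb W := by
  sorry

/-- Statement of `stub_anchorToFermion`. -/
def AnchorToFermionStmt : Prop :=
  ∀ (D D' : DobrushinDomain) (a b : ℝ → Site 2) (ρ : ℝ) (ζ : Site 2 → Fin 4 → ℂ) (c : ℝ → ℝ)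
    (pb : ℝ → Site 2) (W : (δ : ℝ) → (q : Site 2) → (zdGraph 2).Walk (pb δ) q),
    SAW.IsEndpointApprox D a b → SAW.IsEndpointApprox D' a b → IsNested D D' →
    IsBoundaryAnchor D.carrier a → IsBoundaryAnchor D.carrier b → 0 < ρ →
    D'.carrier ∩ ball (D.pt 0) (4 * ρ) = D.carrier ∩ ball (D.pt 0) (4 * ρ) →
    CapCutIdentity D D' a b ρ ζ c pb W →
    ∃ (Λa : ℂ → ℝ) (r : ℝ), 0 < r ∧
      (∀ x₀ ∈ D'.carrier ∩ ball (D.pt 0) r,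
        Tendsto (fun δ => ‖capSum D D'.carrier a b ρ ζ pb W δ‖ * refModulus D.carrier b pb W δ x₀ /
            (‖capSum D D.carrier a b ρ ζ pb W δ‖ * refModulus D'.carrier b pb W δ x₀))
          (𝓝[>] 0) (𝓝 (Λa x₀))) ∧
      Tendsto Λa (𝓝[D'.carrier] (D.pt 0)) (𝓝 1)

/-- **STUB 2 — the `a`-end limit: boundary pair to interior fermion modulus (no conformal data).**
Under the cut identity, the quotient `‖A_{D'}(δ)‖ M_D(δ,x₀) / (‖A_D(δ)‖ M_{D'}(δ,x₀))` — cap-`a`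
averages of the `b`-sourced fermions of the two domains, each SELF-NORMALISED by its modulus at the
common interior point `x₀` — converges for every `x₀ ∈ D'` near `a` to a limit `Λ_a(x₀)`, and
`Λ_a(x₀) → 1` as `x₀ → a`. WHY TRUE: (i) the self-normalised fermions `F_{Ω̂_δ}(b; ·)/M_{Ω̂}(x₀)`
converge in each domain separately (rough source `b`, interior evaluation: HK13 Thm 83 = CS12
Thm 5.9/Cor 5.10, no normalisation at a rough point); (ii) the normalised cap kernel `K_a/ΣK_a`
converges as a measure on the cut with no mass lost at the cut ends (HK13 Thm 83 on the cap, Prop 86 +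
Lemma 87 a-priori bounds, integrable end singularities); (iii) the limit functional is HK13's continuum
convolution kernel (Lemmas 79–80), which on Riemann-BVP solutions of the cap evaluates the VALUE AT `a`
read in the chart `φ` (there `∂` is straight); (iv) in the chart the `b`-fermion of `D` is the constant
`e^{iπ/4}K` and that of `D'` is `e^{iπ/4}K'Φ'_A(u)^{1/2}` (`Φ'_A(∞) = 1`), so the quotient tends to
`Φ'_A(0)^{1/2}(K'/K)·(M_D/M_{D'})(x₀) = d^{1/2}/|Φ'_A(φ⁻¹x₀)|^{1/2} → 1`. If the hypothesised identity
holds for "wrong" data the statement is vacuous or still true (it only pins which real-linear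
functional of the fermion the kernel represents). SIZE: L. -/
theorem stub_anchorToFermion :
    ∀ (D D' : DobrushinDomain) (a b : ℝ → Site 2) (ρ : ℝ) (ζ : Site 2 → Fin 4 → ℂ) (c : ℝ → ℝ)
      (pb : ℝ → Site 2) (W : (δ : ℝ) → (q : Site 2) → (zdGraph 2).Walk (pb δ) q),
      SAW.IsEndpointApprox D a b → SAW.IsEndpointApprox D' a b → IsNested D D' →
      IsBoundaryAnchor D.carrier a → IsBoundaryAnchor D.carrier b → 0 < ρ →
      D'.carrier ∩ ball (D.pt 0) (4 * ρ) = D.carrier ∩ ball (D.pt 0) (4 * ρ) →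
      CapCutIdentity D D' a b ρ ζ c pb W →
      ∃ (Λa : ℂ → ℝ) (r : ℝ), 0 < r ∧
        (∀ x₀ ∈ D'.carrier ∩ ball (D.pt 0) r,
          Tendsto (fun δ => ‖capSum D D'.carrier a b ρ ζ pb W δ‖ * refModulus D.carrier b pb W δ x₀ /
              (‖capSum D D.carrier a b ρ ζ pb W δ‖ * refModulus D'.carrier b pb W δ x₀))
            (𝓝[>] 0) (𝓝 (Λa x₀))) ∧
        Tendsto Λa (𝓝[D'.carrier] (D.pt 0)) (𝓝 1) := by
  sorry

/-- Statement of `stub_fermionModulusRatio`. -/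
def FermionModulusRatioStmt : Prop :=
  ∀ (D D' : DobrushinDomain) (a b : ℝ → Site 2) (pb : ℝ → Site 2)
    (W : (δ : ℝ) → (q : Site 2) → (zdGraph 2).Walk (pb δ) q),
    SAW.IsEndpointApprox D a b → SAW.IsEndpointApprox D' a b → IsNested D D' →
    IsBoundaryAnchor D.carrier a → IsBoundaryAnchor D.carrier b →
    (∀ᶠ δ in 𝓝[>] (0 : ℝ), IsBdryPlaquette D.carrier δ (b δ) (pb δ)) →
    ∀ (φ : ConformalEquiv upperHalfPlaneSet D.carrier), D.IsChordalUniformizing φ →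
    ∀ (A : Set ℂ), A = closure (upperHalfPlaneSet \ {z | z ∈ upperHalfPlaneSet ∧ φ z ∈ D'.carrier}) →
    ∀ (Φ : ConformalEquiv (upperHalfPlaneSet \ A) upperHalfPlaneSet) (d : ℝ),
    IsRestrictionMap A Φ → HasRestrictionDeriv A Φ d →
    ∃ (Λb : ℂ → ℝ) (r : ℝ), 0 < r ∧
      (∀ x₀ ∈ D'.carrier ∩ ball (D.pt 0) r,
        (∀ᶠ δ in 𝓝[>] (0 : ℝ),
          0 < refModulus D.carrier b pb W δ x₀ ∧ 0 < refModulus D'.carrier b pb W δ x₀) ∧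
        Tendsto (fun δ => refModulus D'.carrier b pb W δ x₀ / refModulus D.carrier b pb W δ x₀)
          (𝓝[>] 0) (𝓝 (Λb x₀))) ∧
      Tendsto Λb (𝓝[D'.carrier] (D.pt 0)) (𝓝 (d ^ ((1 : ℝ) / 2)))

/-- **STUB 3 — the `b`-end limit: the fermion-modulus ratio carries the value.** For the `b`-sourced
lattice fermions of `D_δ` and `D'_δ` (source = any boundary plaquettes `pb δ` at `b δ`, any dual
walks), at every interior `x₀ ∈ D'` near `a` both moduli are eventually positive and
`M_{D'}(δ,x₀)/M_D(δ,x₀) → Λ_b(x₀)`, with `Λ_b(x₀) → d^{1/2}` as `x₀ → a`.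
WHY TRUE: the SECOND CUT. By HK13 Lemma 67 at the cap `U_b` (common to both domains) the `b`-sourced
fermion at an interior corner `c` is `C_b(δ)⁻¹ ×` a positive cap-`b` average of the bulk two-point
Kadanoff–Ceva fermion `z ↦ E^free_{Ω̂_δ}[μ σ_{c∘} σ_{z∘}]` on the `b`-cut, with `C_b` COMMON; the bulk
two-point fermion is ABSOLUTELY normalised and `δ⁻¹ ×` it converges in rough simply connected domains
(Hongler–Smirnov 2013 for smooth `Ω` — smoothness only used to count boundary medial vertices —
extended by the full-plane-kernel subtraction + `Im∫F²` machinery of CHI 2015/2021; THIS is the line's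
one non-printed analytic input); kernel shapes at `b` converge as in stub 2. In the chart the two bulk
fermions are `f_ℍ(u,w)` and `Φ'_A(u)^{1/2}Φ'_A(w)^{1/2}f_ℍ(Φ_A u, Φ_A w)` with `Φ_A(w) ∼ w` at `∞ = φ⁻¹b`,
and the two orthogonal source corners make the modulus ratio exactly `|Φ'_A(φ⁻¹x₀)|^{1/2} → d^{1/2}`
(`Φ_A` extends analytically across `ℝ` near `0`, `Φ'_A(0) = d`; `φ⁻¹x₀ → 0` by Carathéodory). The
hypotheses `IsRestrictionMap`/`HasRestrictionDeriv` are used HERE (Disproof §4: any proof must). SIZE: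
L–XL (hardest stub). -/
theorem stub_fermionModulusRatio :
    ∀ (D D' : DobrushinDomain) (a b : ℝ → Site 2) (pb : ℝ → Site 2)
      (W : (δ : ℝ) → (q : Site 2) → (zdGraph 2).Walk (pb δ) q),
      SAW.IsEndpointApprox D a b → SAW.IsEndpointApprox D' a b → IsNested D D' →
      IsBoundaryAnchor D.carrier a → IsBoundaryAnchor D.carrier b →
      (∀ᶠ δ in 𝓝[>] (0 : ℝ), IsBdryPlaquette D.carrier δ (b δ) (pb δ)) →
      ∀ (φ : ConformalEquiv upperHalfPlaneSet D.carrier), D.IsChordalUniformizing φ →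
      ∀ (A : Set ℂ), A = closure (upperHalfPlaneSet \ {z | z ∈ upperHalfPlaneSet ∧ φ z ∈ D'.carrier}) →
      ∀ (Φ : ConformalEquiv (upperHalfPlaneSet \ A) upperHalfPlaneSet) (d : ℝ),
      IsRestrictionMap A Φ → HasRestrictionDeriv A Φ d →
      ∃ (Λb : ℂ → ℝ) (r : ℝ), 0 < r ∧
        (∀ x₀ ∈ D'.carrier ∩ ball (D.pt 0) r,
          (∀ᶠ δ in 𝓝[>] (0 : ℝ),
            0 < refModulus D.carrier b pb W δ x₀ ∧ 0 < refModulus D'.carrier b pb W δ x₀) ∧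
          Tendsto (fun δ => refModulus D'.carrier b pb W δ x₀ / refModulus D.carrier b pb W δ x₀)
            (𝓝[>] 0) (𝓝 (Λb x₀))) ∧
        Tendsto Λb (𝓝[D'.carrier] (D.pt 0)) (𝓝 (d ^ ((1 : ℝ) / 2))) := by
  sorry

/-- **STUB 4 — anchor independence (shared with fk-anchor-renewal / fk-anchor-transfer).** Value-free;
strictly weaker than the crux; the sibling card's lever (Edwards–Sokal, CDH16 b.c.-uniform crossing
bounds, FKG, renewals across conformal half-annuli at a rough free prime end; Disproof §5 shows the
Jordan hypothesis is what excludes shielded endpoints). SIZE: L. -/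
theorem stub_anchorIndependence :
    ∀ (lf : ∀ (Ω : Set ℂ) (δ : ℝ), (discreteDomainGraph Ω δ).LocallyFinite)
      (D D' : DobrushinDomain) (a b a' b' : ℝ → Site 2),
      SAW.IsEndpointApprox D a b → SAW.IsEndpointApprox D' a b →
      SAW.IsEndpointApprox D a' b' → SAW.IsEndpointApprox D' a' b' → IsNested D D' →
      Tendsto (fun δ => ratio lf D D' a b δ - ratio lf D D' a' b' δ) (𝓝[>] 0) (𝓝 0) := by
  sorry

/-- **STUB 5 — boundary-vertex endpoint approximations exist (shared).** Walk from the nearest site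
of an interior point of the agreement ball towards `a` along a lattice line: the last vertex before
leaving `closure D` is a boundary vertex of BOTH mesh domains inside `B(a, ε)`; reachability in both
domains from `JordanDomain.eventually_forall_mem_meshDomain'`. SIZE: S–M (lattice geometry). -/
theorem stub_boundaryApprox :
    ∀ (D D' : DobrushinDomain), IsNested D D' →
      ∃ a b : ℝ → Site 2, SAW.IsEndpointApprox D a b ∧ SAW.IsEndpointApprox D' a b ∧
        IsBoundaryAnchor D.carrier a ∧ IsBoundaryAnchor D.carrier b := by
  sorry

/-! ### Consistency: each named statement IS its registered stub (definitionally) -/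

theorem capCutIdentityStmt_holds : CapCutIdentityStmt := stub_capCutIdentity
theorem anchorToFermionStmt_holds : AnchorToFermionStmt := stub_anchorToFermion
theorem fermionModulusRatioStmt_holds : FermionModulusRatioStmt := stub_fermionModulusRatio
theorem anchorIndependence_holds : AnchorIndependence := stub_anchorIndependence
theorem existsBoundaryApprox_holds : ExistsBoundaryApprox := stub_boundaryApprox

/-! ### Name-keyed aliases of the five statements (the hypotheses of the composition; the native
skeleton audit requires hypotheses admissible BY NAME — same device as
`Summits/ABC/ABC/Cruxes/MazurKaneLaw/Lines/fibre-toolkit-lp-wall-map.lean`) -/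
namespace Registered

/-- Alias of `CapCutIdentityStmt` keyed by the registered stub name. -/
abbrev stub_capCutIdentity : Prop := CapCutIdentityStmt
/-- Alias of `AnchorToFermionStmt` keyed by the registered stub name. -/
abbrev stub_anchorToFermion : Prop := AnchorToFermionStmt
/-- Alias of `FermionModulusRatioStmt` keyed by the registered stub name. -/
abbrev stub_fermionModulusRatio : Prop := FermionModulusRatioStmt
/-- Alias of `AnchorIndependence` keyed by the registered stub name. -/
abbrev stub_anchorIndependence : Prop := AnchorIndependence
/-- Alias of `ExistsBoundaryApprox` keyed by the registered stub name. -/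
abbrev stub_boundaryApprox : Prop := ExistsBoundaryApprox

end Registered

/-! ## §4 Composition (kernel-checked, no sorry) -/

/-- Stubs 1–3 give the boundary-anchor case in normal form: eventually
`ratio_δ = ‖A_{D'}‖/‖A_D‖ = P^a_δ(x₀) · P^b_δ(x₀) → Λ_a(x₀)Λ_b(x₀)` for every interior `x₀` near `a`,
so this product is an `x₀`-independent constant, equal to its limit `1 · d^{1/2}` as `x₀ → a`. -/
theorem ratioTendstoNF_of_stubs (h1 : CapCutIdentityStmt) (h2 : AnchorToFermionStmt)
    (h3 : FermionModulusRatioStmt) {D D' : DobrushinDomain} {a b : ℝ → Site 2}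
    (hD : SAW.IsEndpointApprox D a b) (hD' : SAW.IsEndpointApprox D' a b) (hN : IsNested D D')
    (ha : IsBoundaryAnchor D.carrier a) (hb : IsBoundaryAnchor D.carrier b) :
    RatioTendstoNF D D' a b := by
  intro φ hφ A hA Φ d hR hd
  obtain ⟨ρ, hρ, hagree, ζ, c, pb, W, hId⟩ := h1 D D' a b hD hD' hN ha hb
  obtain ⟨Λa, ra, hra, hconva, hlima⟩ := h2 D D' a b ρ ζ c pb W hD hD' hN ha hb hρ hagree hId
  have hpb : ∀ᶠ δ in 𝓝[>] (0 : ℝ), IsBdryPlaquette D.carrier δ (b δ) (pb δ) :=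
    hId.mono fun δ h => h.2.1
  obtain ⟨Λb, rb, hrb, hconvb, hlimb⟩ := h3 D D' a b pb W hD hD' hN ha hb hpb φ hφ A hA Φ d hR hd
  set r := min ra rb with hr_def
  have hr : 0 < r := lt_min hra hrb
  -- pointwise in the reference point: ratio → Λa x₀ * Λb x₀
  have key : ∀ x₀ ∈ D'.carrier ∩ ball (D.pt 0) r,
      Tendsto (Negative.ratio D D' a b) (𝓝[>] 0) (𝓝 (Λa x₀ * Λb x₀)) := by
    intro x₀ hx₀
    have hxa : x₀ ∈ D'.carrier ∩ ball (D.pt 0) ra :=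
      ⟨hx₀.1, ball_subset_ball (min_le_left _ _) hx₀.2⟩
    have hxb : x₀ ∈ D'.carrier ∩ ball (D.pt 0) rb :=
      ⟨hx₀.1, ball_subset_ball (min_le_right _ _) hx₀.2⟩
    have hA := hconva x₀ hxa
    obtain ⟨hMpos, hB⟩ := hconvb x₀ hxb
    refine (hA.mul hB).congr' ?_
    filter_upwards [hId, hMpos] with δ hδ hM
    obtain ⟨hc, -, hTD, hTD'⟩ := hδ
    obtain ⟨hM1, hM2⟩ := hM
    simp only [Negative.ratio]
    rw [hTD, hTD', mul_div_mul_left _ _ hc.ne']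
    set nA := ‖capSum D D.carrier a b ρ ζ pb W δ‖
    set nA' := ‖capSum D D'.carrier a b ρ ζ pb W δ‖
    set MD := refModulus D.carrier b pb W δ x₀
    set MD' := refModulus D'.carrier b pb W δ x₀
    rw [div_mul_div_comm, show nA' * MD * (MD' : ℝ) = nA' * (MD * MD') by ring,
      show nA * MD' * MD = nA * (MD * MD') by ring, mul_div_mul_right _ _ (mul_pos hM1 hM2).ne']
  -- the marked point is in the closure of `D'`
  have hcl : D.pt 0 ∈ closure D'.carrier := by
    rw [← hN.2.1]
    exact frontier_subset_closure (D'.pt_mem_frontier 0)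
  haveI hne : (𝓝[D'.carrier] (D.pt 0)).NeBot := mem_closure_iff_nhdsWithin_neBot.1 hcl
  obtain ⟨x₁, hx₁D', hx₁⟩ : ∃ x₁ ∈ D'.carrier, dist x₁ (D.pt 0) < r := by
    obtain ⟨y, hy, hyd⟩ := Metric.mem_closure_iff.1 hcl r hr
    exact ⟨y, hy, by rwa [dist_comm]⟩
  have hx₁' : x₁ ∈ D'.carrier ∩ ball (D.pt 0) r := ⟨hx₁D', hx₁⟩
  set L := Λa x₁ * Λb x₁ with hL_def
  have hconst : ∀ x₀ ∈ D'.carrier ∩ ball (D.pt 0) r, Λa x₀ * Λb x₀ = L := fun x₀ hx₀ =>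
    tendsto_nhds_unique (key x₀ hx₀) (key x₁ hx₁')
  -- let the reference point tend to `a` inside `D'`
  have hprod : Tendsto (fun x => Λa x * Λb x) (𝓝[D'.carrier] (D.pt 0))
      (𝓝 (1 * d ^ ((1 : ℝ) / 2))) := hlima.mul hlimb
  have hev : (fun x => Λa x * Λb x) =ᶠ[𝓝[D'.carrier] (D.pt 0)] fun _ => L := by
    have hmem : D'.carrier ∩ ball (D.pt 0) r ∈ 𝓝[D'.carrier] (D.pt 0) :=
      inter_mem_nhdsWithin D'.carrier (ball_mem_nhds _ hr)
    filter_upwards [hmem] with x hx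
    exact hconst x hx
  have hLlim : Tendsto (fun _ : ℂ => L) (𝓝[D'.carrier] (D.pt 0)) (𝓝 (1 * d ^ ((1 : ℝ) / 2))) :=
    hprod.congr' hev
  have hL : L = d ^ ((1 : ℝ) / 2) := by
    have h := tendsto_nhds_unique (tendsto_const_nhds (x := L)) hLlim
    rwa [one_mul] at h
  rw [← hL]
  exact key x₁ hx₁'

/-- The inline (`lf`) form of the ratio is the normal form (`Negative.inline_eq_T`, landed p73059). -/
theorem ratio_eq_negativeRatio (lf : ∀ (Ω : Set ℂ) (δ : ℝ), (discreteDomainGraph Ω δ).LocallyFinite)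
    (D D' : DobrushinDomain) (a b : ℝ → Site 2) :
    ratio lf D D' a b = Negative.ratio D D' a b := by
  funext δ
  simp only [ratio, twoPt, Negative.inline_eq_T, Negative.ratio]

/-- Stubs 1–3 give the line's OUTPUT `BoundaryAnchorRatio`. -/
theorem boundaryAnchorRatio_of_stubs (h1 : CapCutIdentityStmt) (h2 : AnchorToFermionStmt)
    (h3 : FermionModulusRatioStmt) : BoundaryAnchorRatio := by
  intro lf D D' a b hD hD' hN ha hb φ hφ A hA Φ d hR hd
  rw [ratio_eq_negativeRatio]
  exact ratioTendstoNF_of_stubs h1 h2 h3 hD hD' hN ha hb φ hφ A hA Φ d hR hd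

/-- **THE LINE CONCLUDES THE CRUX BY NAME**: the five registered stubs imply
`Summit.CriticalPhenomena.SAWScalingLimit.Theses.SAWLoopFugacityFlow.IsingBoundaryRatio`.
TRANSFER step (pure bookkeeping, as in `SketchIdeator2.AnchorRenewal.transfer`): anchor independence +
the boundary-anchor case (from stubs 1–3) + one boundary approximation ⇒ the crux for every
`IsEndpointApprox`: `ratio a b = ratio a' b' + (ratio a b - ratio a' b') → d^{1/2} + 0`. -/
theorem IsingBoundaryRatio_of (h1 : Registered.stub_capCutIdentity)
    (h2 : Registered.stub_anchorToFermion) (h3 : Registered.stub_fermionModulusRatio)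
    (hAI : Registered.stub_anchorIndependence) (hEx : Registered.stub_boundaryApprox) :
    Summit.CriticalPhenomena.SAWScalingLimit.Theses.SAWLoopFugacityFlow.IsingBoundaryRatio := by
  have hBA : BoundaryAnchorRatio := boundaryAnchorRatio_of_stubs h1 h2 h3
  intro lf D D' a b hab hab' h3' h4 h5 h6 φ hφ A hA Φ d hR hD
  obtain ⟨a', b', h1', h1'', hb1, hb2⟩ := hEx D D' ⟨h3', h4, h5, h6⟩
  have T1 := hBA lf D D' a' b' h1' h1'' ⟨h3', h4, h5, h6⟩ hb1 hb2 φ hφ A hA Φ d hR hD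
  have T2 := hAI lf D D' a b a' b' hab hab' h1' h1'' ⟨h3', h4, h5, h6⟩
  have T := T1.add T2
  have hfun : (fun δ => ratio lf D D' a' b' δ + (ratio lf D D' a b δ - ratio lf D D' a' b' δ)) =
      ratio lf D D' a b := by
    funext δ; ring
  rw [hfun, add_zero] at T
  exact T

end Summit.CriticalPhenomena.SAWScalingLimit.Cruxes.IsingBoundaryRatio.DoubleCutPositiveKernel

end
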